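import Summits.QuantumFields.BalabanUV.Beta.D1BFx.GhostSplitJets

/-!
# `BalabanUV.Beta.D1BFx.GhostCompressionJets` — road «BF-x» for binder row D1, slot (K), X₃(ii) ROUTE T, Tier B brick **K-TB3a** (part 2 of 2)
# «GHOST SPLIT, JET FORM» (model): the COMPRESSION `h[NᵀXN] = h[kkt X Q]` (constant basis of `ker Q`, constant Gram factors) and the
# BORDER ∕ SHIFT congruences `h[kkt X Q] = h[kkt (X + QᵀB + CQ) Q]`, `h[kkt Δ² Q] = h[kkt (Δ + QᵀaQ)² Q]`, from 2-JETS ONLY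

HONEST DEPENDENCY (cell records, verbatim): «continuum YM on T⁴ ⇐ BetaPertH ∧ nine spine estimates (0/9 proved); BetaPertH ⇐ (D1) ∧ (D4) ∧
CAP+tail; G-an2-4 gates asym, D1 and NE2/3/4.»  HONEST FRAMING (cell contract, verbatim): «discharging `BetaPertH` makes Bałaban's UV stability
UNCONDITIONAL — a real constructive-QFT result; it is NOT the continuum limit and NOT the Clay problem.»  THIS MODULE DISCHARGES NOTHING of (K),
of D1 or of the wall: [folklore] finite-dimensional matrix calculus (Mathlib) over the road owner's model chain — `SliceTransferBordered`
(`det_kkt_mul_det_gram`), `SliceTransferGhostJets` (`secondVar_kkt_congr_of_border`), `LogDetSecondVariation` (`secondVar_comb_eq_zero`), the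
quadratic Taylor curves `SliceTransferJets.pc∕lc` — and part 1 `GhostSplitJets` (polarisation bookkeeping).  No `def`, no `def … : Prop`, nothing
cited, 0 sorry; 0∕4 row-D1 binders; NOT D1, NOT BetaPertH, NOT continuum, NOT Clay.

ABSOLUTE RULE (cell charter, verbatim): «No internally-minted statement may enter as a cited fact. Every hypothesis is either kernel-proved in this
package or a verbatim quotation of a PUBLISHED theorem with page reference. The manuscript(s) under audit are NOT citable for their own disputed
steps — they are the thing under adjudication; programme-internal (2001/route/tribunal) claims are never citable.»

WHERE THIS SITS (`HOME/b2b-balaban-beta-d1-p2/K-ASSEMBLY-SPEC-v2.md` v2.0 §0 DECISION 2, §2 brick K-TB3a).  DECISION 2 reads the Faddeev–Popov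
Gram `Φ_F(u) = Nᵀ X(u) N` (block-mean-free basis `N` of `ker Q′`, CONSTANT; `X(u) = 2Δ_u²`) as `det`-equivalent to the bordered `kkt X(u) Q′`
(`det_kkt_mul_det_gram`, constant Gram factors `det(NᵀN)`, `det(Q′Q′ᵀ)`) and then to `kkt (Δ_u + Q′ᵀa_uQ′)² Q′` (shift), which part 1 splits.
Those two steps exist in the tree ALONG `C²` CURVES; the torus∕kernel consumer (TB3b∕c, TB5) has 2-JETS (tables).  This file gives the jet
forms — identities between `secondVar`∕`mixedVar`∕`hessT` of MATRICES, the derived jets entering as letters with their product-rule equations.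
Method: quadratic Taylor curves `pc` realise the jets; `u ↦ NᵀX(u)N` is itself the Taylor curve of the sandwiched jets (`of_pc_sandwich`);
`secondVar_comb_eq_zero` (two curves of DIFFERENT sizes whose `log|det|` differ by a constant) replaces `secondVar_eq_of_logAbsDet_eq`;
polarisation with zero pure second jets of the primary letters (part 1's `two_mul_mixedVar_eq_polar`, `kkt_zero_polar`, `kkt_add_zero`).

CONTENT (all [folklore]):
* §1 `logAbsDet_kkt_eq_compressed` (pointwise: `Q N = 0`, `det(QQᵀ) ≠ 0`, `det(NᵀN) ≠ 0`, `det(NᵀXN) ≠ 0` ⟹ `det kkt X Q ≠ 0` and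
  `log|det kkt X Q| = log|det NᵀXN| + (log|det QQᵀ| − log|det NᵀN|)`), `of_pc_sandwich`, **`secondVar_compressed_jets`** (ANY 2-jet `X₀ X₁ X₂`:
  `secondVar (NᵀX₀N) (NᵀX₁N) (NᵀX₂N) = secondVar (kkt X₀ Q) (kkt X₁ 0) (kkt X₂ 0)`), **`mixedVar_compressed_jets`**, **`hessT_compressed_jets`**
  (`hessT (NᵀX₀N)⁻¹ (NᵀXₛN) (NᵀXₜN) (NᵀXₛₜN) = hessT (kkt X₀ Q)⁻¹ (kkt Xₛ 0) (kkt Xₜ 0) (kkt Xₛₜ 0)`).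
* §2 **`secondVar_kkt_border_jets`** (the `X′`-jets = `X`-jets + product-rule jets of `QᵀB + CQ`, `Q` WITH jets, `B`, `C` free letters:
  same bordered functional), **`secondVar_kkt_shift_sq_jets`** ∕ **`mixedVar_kkt_shift_sq_jets`** ∕ **`hessT_kkt_shift_sq_jets`** (constant `Q`;
  the `Δ·Δ`-jets and the `M·M`-jets with `Mᵢ = Δᵢ + Qᵀ(aᵢQ)` have the same bordered functional).
NOT HERE: the split itself (part 1), periodisation, `ℤ⁴` kernels, the torus objects of TB3b, ghost legs TB3c, comb Gram TB3d, TB4∕TB5.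
Provenance: NE9 formalisation swarm leaf seat `b2b-balaban-t4-ne9-formalise-leaf-02` gen 25 (cross-row, road «BF-x» brick K-TB3a on the owner's
invitation `K-ASSEMBLY-SPEC-v2.md` §5 «CLAIMABLE NOW»), 2026-08-20.
-/

noncomputable section

namespace Summit.QuantumFields.BalabanUV.Beta.D1BFx.GhostCompressionJets

open Matrix Filter
open scoped Topology
open Literature.MathematicalPhysics.QuantumFieldTheory.Balaban1983to89.Beta.Composition (kkt)
open Literature.Analysis.Calculus (eventually_det_ne_zero)
open Summit.QuantumFields.BalabanUV.Beta.D1BFx.LogDetSecondVariation (secondVar secondVar_comb_eq_zero)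
open Summit.QuantumFields.BalabanUV.Beta.D1BFx.SliceTransferModel (hasDerivAt_matMul hasDerivAt_transpose hasDerivAt_kkt)
open Summit.QuantumFields.BalabanUV.Beta.D1BFx.SliceTransferJets (pc lc of_pc of_lc of_pc_zero of_lc_zero hasDerivAt_pc hasDerivAt_lc)
open Summit.QuantumFields.BalabanUV.Beta.D1BFx.SliceTransferJetsMixed (mixedVar)
open Summit.QuantumFields.BalabanUV.Beta.D1BFx.SliceTransferBordered (det_kkt_mul_det_gram)
open Summit.QuantumFields.BalabanUV.Beta.D1BFx.SliceTransferGhostJets (secondVar_kkt_congr_of_border)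
open Summit.QuantumFields.BalabanUV.Beta.D1BFx.MixedVarPackedHess (hessT mixedVar_eq_two_mul_hessT)
open Summit.QuantumFields.BalabanUV.Beta.D1BFx.GhostSplitJets (two_mul_mixedVar_eq_polar kkt_zero_polar kkt_add_zero)

/-! ## §1 Compression with a constant basis and constraint: the ghost Gram `NᵀXN` versus the bordered `kkt X Q` -/

section Compression

variable {σ κ : Type*} [Fintype σ] [Fintype κ] [DecidableEq σ] [DecidableEq κ]

/-- [folklore] POINTWISE: `Q N = 0`, `det(QQᵀ) ≠ 0`, `det(NᵀN) ≠ 0`, `det(NᵀXN) ≠ 0` ⟹ `det kkt X Q ≠ 0` and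
`log|det kkt X Q| = log|det(NᵀXN)| + (log|det(QQᵀ)| − log|det(NᵀN)|)` (`SliceTransferBordered.det_kkt_mul_det_gram` in logarithms). -/
theorem logAbsDet_kkt_eq_compressed (X : Matrix (σ ⊕ κ) (σ ⊕ κ) ℝ) (Q : Matrix κ (σ ⊕ κ) ℝ) (N : Matrix (σ ⊕ κ) σ ℝ)
    (hQN : Q * N = 0) (hQ : (Q * Qᵀ).det ≠ 0) (hN : (Nᵀ * N).det ≠ 0) (hX : (Nᵀ * X * N).det ≠ 0) :
    (kkt X Q).det ≠ 0 ∧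
      Real.log |(kkt X Q).det| = Real.log |(Nᵀ * X * N).det| + (Real.log |(Q * Qᵀ).det| - Real.log |(Nᵀ * N).det|) := by
  have h := det_kkt_mul_det_gram X Q N hQN hQ
  have habs : |(kkt X Q).det| * |(Nᵀ * N).det| = |(Nᵀ * X * N).det| * |(Q * Qᵀ).det| := by
    have := congrArg abs h
    rwa [abs_mul, abs_mul, abs_mul, abs_pow, abs_neg, abs_one, one_pow, one_mul] at this
  have hk : (kkt X Q).det ≠ 0 := by
    intro h0
    rw [h0, abs_zero, zero_mul] at habs
    exact mul_ne_zero (abs_ne_zero.2 hX) (abs_ne_zero.2 hQ) habs.symm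
  refine ⟨hk, ?_⟩
  have hl := congrArg Real.log habs
  rw [Real.log_mul (abs_ne_zero.2 hk) (abs_ne_zero.2 hN), Real.log_mul (abs_ne_zero.2 hX) (abs_ne_zero.2 hQ)] at hl
  linarith

omit [DecidableEq σ] [DecidableEq κ] in
/-- [folklore] The quadratic Taylor curve commutes with a constant sandwich: `pc (NᵀX₀N) (NᵀX₁N) (NᵀX₂N) (u) = Nᵀ·pc X₀ X₁ X₂ (u)·N`. -/
theorem of_pc_sandwich (X₀ X₁ X₂ : Matrix (σ ⊕ κ) (σ ⊕ κ) ℝ) (N : Matrix (σ ⊕ κ) σ ℝ) (u : ℝ) :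
    Matrix.of (pc (Nᵀ * X₀ * N) (Nᵀ * X₁ * N) (Nᵀ * X₂ * N) u) = Nᵀ * Matrix.of (pc X₀ X₁ X₂ u) * N := by
  simp only [of_pc, Matrix.mul_add, Matrix.add_mul, Matrix.mul_smul, Matrix.smul_mul]

/-- [folklore] **COMPRESSION, JET FORM** (constant basis `N` of `ker Q`, constant constraint `Q` — the «constant Gram factors» case of DECISION 2):
for ANY 2-jet `X₀ X₁ X₂` with `det(NᵀX₀N) ≠ 0`,
`secondVar (NᵀX₀N) (NᵀX₁N) (NᵀX₂N) = secondVar (kkt X₀ Q) (kkt X₁ 0) (kkt X₂ 0)` — the one-loop functional of the ghost Gram `NᵀXN` IS the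
bordered one with silent constraint jets (the two Gram determinants are constant in `u` and drop out upon differentiation). -/
theorem secondVar_compressed_jets (X₀ X₁ X₂ : Matrix (σ ⊕ κ) (σ ⊕ κ) ℝ) (Q : Matrix κ (σ ⊕ κ) ℝ) (N : Matrix (σ ⊕ κ) σ ℝ)
    (hQN : Q * N = 0) (hQ : (Q * Qᵀ).det ≠ 0) (hN : (Nᵀ * N).det ≠ 0) (hd : (Nᵀ * X₀ * N).det ≠ 0) :
    secondVar (Nᵀ * X₀ * N) (Nᵀ * X₁ * N) (Nᵀ * X₂ * N)
      = secondVar (kkt X₀ Q) (kkt X₁ (0 : Matrix κ (σ ⊕ κ) ℝ)) (kkt X₂ (0 : Matrix κ (σ ⊕ κ) ℝ)) := by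
  -- the bordered curve `u ↦ kkt (pc X u) Q` (constant constraint) and its jets
  have hQ0 : ∀ u : ℝ, HasDerivAt (fun _ : ℝ => Matrix.of.symm Q) ((fun _ : ℝ => Matrix.of.symm (0 : Matrix κ (σ ⊕ κ) ℝ)) u) u :=
    fun u => hasDerivAt_const u _
  have hQ00 : HasDerivAt (fun _ : ℝ => Matrix.of.symm (0 : Matrix κ (σ ⊕ κ) ℝ)) (Matrix.of.symm (0 : Matrix κ (σ ⊕ κ) ℝ)) 0 :=
    hasDerivAt_const _ _
  have hA : ∀ u, HasDerivAt (fun u => Matrix.of.symm (kkt (Matrix.of (pc X₀ X₁ X₂ u)) (Matrix.of ((fun _ : ℝ => Matrix.of.symm Q) u))))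
      ((fun u => Matrix.of.symm (kkt (Matrix.of (lc X₁ X₂ u))
        (Matrix.of ((fun _ : ℝ => Matrix.of.symm (0 : Matrix κ (σ ⊕ κ) ℝ)) u)))) u) u :=
    fun u => hasDerivAt_kkt (hasDerivAt_pc X₀ X₁ X₂ u) (hQ0 u)
  have hA₁ : HasDerivAt (fun u => Matrix.of.symm (kkt (Matrix.of (lc X₁ X₂ u))
        (Matrix.of ((fun _ : ℝ => Matrix.of.symm (0 : Matrix κ (σ ⊕ κ) ℝ)) u))))
      (Matrix.of.symm (kkt X₂ (0 : Matrix κ (σ ⊕ κ) ℝ))) 0 :=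
    hasDerivAt_kkt (hasDerivAt_lc X₁ X₂ 0) hQ00
  -- the ghost Gram curve is the Taylor curve of the sandwiched jets
  have hB : ∀ u, HasDerivAt (pc (Nᵀ * X₀ * N) (Nᵀ * X₁ * N) (Nᵀ * X₂ * N)) (lc (Nᵀ * X₁ * N) (Nᵀ * X₂ * N) u) u :=
    hasDerivAt_pc _ _ _
  have hB₁ := hasDerivAt_lc (Nᵀ * X₁ * N) (Nᵀ * X₂ * N) (0 : ℝ)
  have hdB : (Matrix.of (pc (Nᵀ * X₀ * N) (Nᵀ * X₁ * N) (Nᵀ * X₂ * N) 0)).det ≠ 0 := by rw [of_pc_zero]; exact hd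
  have hdA : (Matrix.of ((fun u => Matrix.of.symm (kkt (Matrix.of (pc X₀ X₁ X₂ u)) (Matrix.of ((fun _ : ℝ => Matrix.of.symm Q) u)))) 0)).det
      ≠ 0 := by
    simp only [of_pc_zero, Equiv.apply_symm_apply]
    exact (logAbsDet_kkt_eq_compressed X₀ Q N hQN hQ hN hd).1
  -- near `0` the two `log|det|` differ by the constant Gram term
  have hne : ∀ᶠ u in 𝓝 (0 : ℝ), (Matrix.of (pc (Nᵀ * X₀ * N) (Nᵀ * X₁ * N) (Nᵀ * X₂ * N) u)).det ≠ 0 :=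
    eventually_det_ne_zero (hB 0).hasFDerivAt hdB
  have heq : ∀ᶠ u in 𝓝 (0 : ℝ),
      1 * Real.log |(Matrix.of ((fun u => Matrix.of.symm (kkt (Matrix.of (pc X₀ X₁ X₂ u))
          (Matrix.of ((fun _ : ℝ => Matrix.of.symm Q) u)))) u)).det|
        + (-1) * Real.log |(Matrix.of (pc (Nᵀ * X₀ * N) (Nᵀ * X₁ * N) (Nᵀ * X₂ * N) u)).det|
        + 0 * Real.log |(Matrix.of (pc (Nᵀ * X₀ * N) (Nᵀ * X₁ * N) (Nᵀ * X₂ * N) u)).det|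
        + 0 * Real.log |(Matrix.of (pc (Nᵀ * X₀ * N) (Nᵀ * X₁ * N) (Nᵀ * X₂ * N) u)).det|
        = Real.log |(Q * Qᵀ).det| - Real.log |(Nᵀ * N).det| := by
    filter_upwards [hne] with u hu
    rw [of_pc_sandwich] at hu ⊢
    simp only [Equiv.apply_symm_apply]
    rw [(logAbsDet_kkt_eq_compressed _ Q N hQN hQ hN hu).2]
    ring
  have h := secondVar_comb_eq_zero (a := 1) (b := -1) (c := 0) (d := 0) (t := 0)
    (A₂ := kkt X₂ (0 : Matrix κ (σ ⊕ κ) ℝ)) (B₂ := Nᵀ * X₂ * N) (C₂ := Nᵀ * X₂ * N) (D₂ := Nᵀ * X₂ * N)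
    (Filter.Eventually.of_forall hA) hA₁ hdA (Filter.Eventually.of_forall hB) hB₁ hdB
    (Filter.Eventually.of_forall hB) hB₁ hdB (Filter.Eventually.of_forall hB) hB₁ hdB heq
  simp only [of_pc_zero, of_lc_zero, Equiv.apply_symm_apply] at h
  linarith

/-- [folklore] **COMPRESSION, MIXED JET FORM**: `mixedVar (NᵀX₀N) (NᵀXₛN) (NᵀXₜN) (NᵀXₛₜN) = mixedVar (kkt X₀ Q) (kkt Xₛ 0) (kkt Xₜ 0) (kkt Xₛₜ 0)`. -/
theorem mixedVar_compressed_jets (X₀ Xₛ Xₜ Xₛₜ : Matrix (σ ⊕ κ) (σ ⊕ κ) ℝ) (Q : Matrix κ (σ ⊕ κ) ℝ) (N : Matrix (σ ⊕ κ) σ ℝ)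
    (hQN : Q * N = 0) (hQ : (Q * Qᵀ).det ≠ 0) (hN : (Nᵀ * N).det ≠ 0) (hd : (Nᵀ * X₀ * N).det ≠ 0) :
    mixedVar (Nᵀ * X₀ * N) (Nᵀ * Xₛ * N) (Nᵀ * Xₜ * N) (Nᵀ * Xₛₜ * N)
      = mixedVar (kkt X₀ Q) (kkt Xₛ (0 : Matrix κ (σ ⊕ κ) ℝ)) (kkt Xₜ (0 : Matrix κ (σ ⊕ κ) ℝ)) (kkt Xₛₜ (0 : Matrix κ (σ ⊕ κ) ℝ)) := by
  have hs := secondVar_compressed_jets X₀ Xₛ 0 Q N hQN hQ hN hd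
  have ht := secondVar_compressed_jets X₀ Xₜ 0 Q N hQN hQ hN hd
  have hdg := secondVar_compressed_jets X₀ (Xₛ + Xₜ) (0 + (2 : ℝ) • Xₛₜ + 0) Q N hQN hQ hN hd
  have e1 : Nᵀ * (Xₛ + Xₜ) * N = Nᵀ * Xₛ * N + Nᵀ * Xₜ * N := by rw [Matrix.mul_add, Matrix.add_mul]
  have e2 : Nᵀ * (0 + (2 : ℝ) • Xₛₜ + 0) * N
      = Nᵀ * (0 : Matrix (σ ⊕ κ) (σ ⊕ κ) ℝ) * N + (2 : ℝ) • (Nᵀ * Xₛₜ * N) + Nᵀ * (0 : Matrix (σ ⊕ κ) (σ ⊕ κ) ℝ) * N := by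
    rw [Matrix.mul_add, Matrix.mul_add, Matrix.add_mul, Matrix.add_mul, Matrix.mul_smul, Matrix.smul_mul]
  rw [e1, e2, kkt_zero_polar, kkt_add_zero] at hdg
  have pB := two_mul_mixedVar_eq_polar (Nᵀ * X₀ * N) (Nᵀ * Xₛ * N) (Nᵀ * Xₜ * N) (Nᵀ * (0 : Matrix (σ ⊕ κ) (σ ⊕ κ) ℝ) * N)
    (Nᵀ * (0 : Matrix (σ ⊕ κ) (σ ⊕ κ) ℝ) * N) (Nᵀ * Xₛₜ * N)
  have pA := two_mul_mixedVar_eq_polar (kkt X₀ Q) (kkt Xₛ (0 : Matrix κ (σ ⊕ κ) ℝ)) (kkt Xₜ 0) (kkt 0 0) (kkt 0 0) (kkt Xₛₜ 0)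
  linarith

/-- [folklore] **COMPRESSION IN THE `hessT` CURRENCY**: `hessT (NᵀX₀N)⁻¹ (NᵀXₛN) (NᵀXₜN) (NᵀXₛₜN) = hessT (kkt X₀ Q)⁻¹ (kkt Xₛ 0) (kkt Xₜ 0) (kkt Xₛₜ 0)`
— the ghost `hessT (Φ_F⁻¹; Φ-jets)` of the Gram form, `Φ_F = NᵀXN`, read as a bordered functional with silent constraint jets. -/
theorem hessT_compressed_jets (X₀ Xₛ Xₜ Xₛₜ : Matrix (σ ⊕ κ) (σ ⊕ κ) ℝ) (Q : Matrix κ (σ ⊕ κ) ℝ) (N : Matrix (σ ⊕ κ) σ ℝ)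
    (hQN : Q * N = 0) (hQ : (Q * Qᵀ).det ≠ 0) (hN : (Nᵀ * N).det ≠ 0) (hd : (Nᵀ * X₀ * N).det ≠ 0) :
    hessT (Nᵀ * X₀ * N)⁻¹ (Nᵀ * Xₛ * N) (Nᵀ * Xₜ * N) (Nᵀ * Xₛₜ * N)
      = hessT (kkt X₀ Q)⁻¹ (kkt Xₛ (0 : Matrix κ (σ ⊕ κ) ℝ)) (kkt Xₜ (0 : Matrix κ (σ ⊕ κ) ℝ)) (kkt Xₛₜ (0 : Matrix κ (σ ⊕ κ) ℝ)) := by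
  have h := mixedVar_compressed_jets X₀ Xₛ Xₜ Xₛₜ Q N hQN hQ hN hd
  rw [mixedVar_eq_two_mul_hessT, mixedVar_eq_two_mul_hessT] at h
  linarith

end Compression

/-! ## §2 Border and shift congruence in jet form -/

section Shift

variable {ν μ : Type*} [Fintype ν] [Fintype μ] [DecidableEq ν] [DecidableEq μ]

/-- [folklore] **BASIS-FREE COMPRESSION INVARIANCE, JET FORM** (`SliceTransferGhostJets.secondVar_kkt_congr_of_border` without curves): if the
`X′`-jets are the `X`-jets plus the product-rule jets of a constraint-directed perturbation `QᵀB + CQ` (free letters `B₀ B₁ B₂`, `C₀ C₁ C₂`; the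
constraint `Q` with its own jets `Q₀ Q₁ Q₂`), the bordered functionals agree:
`secondVar (kkt X₀ Q₀) (kkt X₁ Q₁) (kkt X₂ Q₂) = secondVar (kkt X₀′ Q₀) (kkt X₁′ Q₁) (kkt X₂′ Q₂)` (`det kkt X₀ Q₀ ≠ 0`). -/
theorem secondVar_kkt_border_jets (X₀ X₁ X₂ X₀' X₁' X₂' : Matrix ν ν ℝ) (Q₀ Q₁ Q₂ B₀ B₁ B₂ : Matrix μ ν ℝ) (C₀ C₁ C₂ : Matrix ν μ ℝ)
    (h₀ : X₀' = X₀ + Q₀ᵀ * B₀ + C₀ * Q₀)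
    (h₁ : X₁' = X₁ + (Q₁ᵀ * B₀ + Q₀ᵀ * B₁) + (C₁ * Q₀ + C₀ * Q₁))
    (h₂ : X₂' = X₂ + (Q₂ᵀ * B₀ + (2 : ℝ) • (Q₁ᵀ * B₁) + Q₀ᵀ * B₂) + (C₂ * Q₀ + (2 : ℝ) • (C₁ * Q₁) + C₀ * Q₂))
    (hd : (kkt X₀ Q₀).det ≠ 0) :
    secondVar (kkt X₀ Q₀) (kkt X₁ Q₁) (kkt X₂ Q₂) = secondVar (kkt X₀' Q₀) (kkt X₁' Q₁) (kkt X₂' Q₂) := by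
  have h0 : (0 : ℝ) ^ 2 / 2 = 0 := by norm_num
  have hQc : ∀ u, HasDerivAt (pc Q₀ Q₁ Q₂) (lc Q₁ Q₂ u) u := hasDerivAt_pc Q₀ Q₁ Q₂
  have hT : ∀ u, HasDerivAt (fun u => Matrix.of.symm (Matrix.of (pc Q₀ Q₁ Q₂ u))ᵀ) (Matrix.of.symm (Matrix.of (lc Q₁ Q₂ u))ᵀ) u :=
    fun u => hasDerivAt_transpose (hQc u)
  -- the perturbed curve `X′(u) := X(u) + Q(u)ᵀ B(u) + C(u) Q(u)`, `B`, `C` the Taylor curves of the free letters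
  have hX'c : ∀ u, HasDerivAt (fun u => Matrix.of.symm (Matrix.of (pc X₀ X₁ X₂ u)
      + Matrix.of ((fun u => Matrix.of.symm ((Matrix.of (pc Q₀ Q₁ Q₂ u))ᵀ * Matrix.of (pc B₀ B₁ B₂ u))) u)
      + Matrix.of ((fun u => Matrix.of.symm (Matrix.of (pc C₀ C₁ C₂ u) * Matrix.of (pc Q₀ Q₁ Q₂ u))) u)))
      ((fun u => Matrix.of.symm (Matrix.of (lc X₁ X₂ u)
        + ((Matrix.of (lc Q₁ Q₂ u))ᵀ * Matrix.of (pc B₀ B₁ B₂ u) + (Matrix.of (pc Q₀ Q₁ Q₂ u))ᵀ * Matrix.of (lc B₁ B₂ u))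
        + (Matrix.of (lc C₁ C₂ u) * Matrix.of (pc Q₀ Q₁ Q₂ u) + Matrix.of (pc C₀ C₁ C₂ u) * Matrix.of (lc Q₁ Q₂ u)))) u) u :=
    fun u => ((hasDerivAt_pc X₀ X₁ X₂ u).add (hasDerivAt_matMul (X := fun u => Matrix.of.symm (Matrix.of (pc Q₀ Q₁ Q₂ u))ᵀ) (hT u)
      (hasDerivAt_pc B₀ B₁ B₂ u))).add (hasDerivAt_matMul (hasDerivAt_pc C₀ C₁ C₂ u) (hQc u))
  have hX'₁ : HasDerivAt (fun u => Matrix.of.symm (Matrix.of (lc X₁ X₂ u)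
        + ((Matrix.of (lc Q₁ Q₂ u))ᵀ * Matrix.of (pc B₀ B₁ B₂ u) + (Matrix.of (pc Q₀ Q₁ Q₂ u))ᵀ * Matrix.of (lc B₁ B₂ u))
        + (Matrix.of (lc C₁ C₂ u) * Matrix.of (pc Q₀ Q₁ Q₂ u) + Matrix.of (pc C₀ C₁ C₂ u) * Matrix.of (lc Q₁ Q₂ u))))
      (Matrix.of.symm (X₂ + (Q₂ᵀ * B₀ + Q₁ᵀ * B₁ + (Q₁ᵀ * B₁ + Q₀ᵀ * B₂)) + (C₂ * Q₀ + C₁ * Q₁ + (C₁ * Q₁ + C₀ * Q₂)))) 0 := by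
    have hT₁ : HasDerivAt (fun u => Matrix.of.symm (Matrix.of (lc Q₁ Q₂ u))ᵀ) (Matrix.of.symm Q₂ᵀ) 0 :=
      hasDerivAt_transpose (hasDerivAt_lc Q₁ Q₂ 0)
    have h := ((hasDerivAt_lc X₁ X₂ 0).add
      ((hasDerivAt_matMul (X := fun u => Matrix.of.symm (Matrix.of (lc Q₁ Q₂ u))ᵀ) hT₁ (hasDerivAt_pc B₀ B₁ B₂ 0)).add
        (hasDerivAt_matMul (X := fun u => Matrix.of.symm (Matrix.of (pc Q₀ Q₁ Q₂ u))ᵀ) (hT 0) (hasDerivAt_lc B₁ B₂ 0)))).add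
      ((hasDerivAt_matMul (hasDerivAt_lc C₁ C₂ 0) (hQc 0)).add (hasDerivAt_matMul (hasDerivAt_pc C₀ C₁ C₂ 0) (hasDerivAt_lc Q₁ Q₂ 0)))
    refine h.congr_deriv ?_
    simp only [of_pc, of_lc, h0, zero_smul, add_zero, Equiv.apply_symm_apply]
    rfl
  have hdA : (kkt (Matrix.of (pc X₀ X₁ X₂ 0)) (Matrix.of (pc Q₀ Q₁ Q₂ 0))).det ≠ 0 := by rw [of_pc_zero, of_pc_zero]; exact hd
  have h := secondVar_kkt_congr_of_border (X := pc X₀ X₁ X₂) (X₁ := lc X₁ X₂) (X₂ := X₂) (Q := pc Q₀ Q₁ Q₂) (Q₁ := lc Q₁ Q₂) (Q₂ := Q₂)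
    (B := fun u => Matrix.of (pc B₀ B₁ B₂ u)) (C := fun u => Matrix.of (pc C₀ C₁ C₂ u))
    (Filter.Eventually.of_forall (hasDerivAt_pc X₀ X₁ X₂)) (hasDerivAt_lc X₁ X₂ 0)
    (Filter.Eventually.of_forall hX'c) hX'₁ (Filter.Eventually.of_forall hQc) (hasDerivAt_lc Q₁ Q₂ 0)
    (Filter.Eventually.of_forall fun u => rfl) hdA
  simp only [of_pc, of_lc, h0, zero_smul, add_zero, Equiv.apply_symm_apply] at h
  subst h₀ h₁ h₂
  convert h using 3
  simp only [two_smul]; abel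

/-- [folklore] **THE SHIFT CONGRUENCE, JET FORM** (constant constraint `Q`): the 2-jets of `Δ·Δ` and of `M·M`, `Mᵢ = Δᵢ + Qᵀ(aᵢQ)` (free letters
`a₀ a₁ a₂`), have the same bordered functional:
`secondVar (kkt X₀ Q) (kkt X₁ 0) (kkt X₂ 0) = secondVar (kkt X₀′ Q) (kkt X₁′ 0) (kkt X₂′ 0)` (`det kkt X₀ Q ≠ 0`) — the road's
«`h[kkt Δ_U² Q′] = h[kkt (Δ_U + Q′ᵀaQ′)² Q′]`», after which part 1 splits the square `M·M`. -/
theorem secondVar_kkt_shift_sq_jets (Δ₀ Δ₁ Δ₂ M₀ M₁ M₂ X₀ X₁ X₂ X₀' X₁' X₂' : Matrix ν ν ℝ) (Q : Matrix μ ν ℝ) (a₀ a₁ a₂ : Matrix μ μ ℝ)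
    (hM₀ : M₀ = Δ₀ + Qᵀ * (a₀ * Q)) (hM₁ : M₁ = Δ₁ + Qᵀ * (a₁ * Q)) (hM₂ : M₂ = Δ₂ + Qᵀ * (a₂ * Q))
    (hX₀ : X₀ = Δ₀ * Δ₀) (hX₁ : X₁ = Δ₁ * Δ₀ + Δ₀ * Δ₁) (hX₂ : X₂ = Δ₂ * Δ₀ + (2 : ℝ) • (Δ₁ * Δ₁) + Δ₀ * Δ₂)
    (hX₀' : X₀' = M₀ * M₀) (hX₁' : X₁' = M₁ * M₀ + M₀ * M₁) (hX₂' : X₂' = M₂ * M₀ + (2 : ℝ) • (M₁ * M₁) + M₀ * M₂)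
    (hd : (kkt X₀ Q).det ≠ 0) :
    secondVar (kkt X₀ Q) (kkt X₁ (0 : Matrix μ ν ℝ)) (kkt X₂ (0 : Matrix μ ν ℝ))
      = secondVar (kkt X₀' Q) (kkt X₁' (0 : Matrix μ ν ℝ)) (kkt X₂' (0 : Matrix μ ν ℝ)) := by
  refine secondVar_kkt_border_jets X₀ X₁ X₂ X₀' X₁' X₂' Q 0 0
    (a₀ * Q * Δ₀ + a₀ * Q * Qᵀ * (a₀ * Q)) (a₁ * Q * Δ₀ + a₁ * Q * Qᵀ * (a₀ * Q) + (a₀ * Q * Δ₁ + a₀ * Q * Qᵀ * (a₁ * Q)))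
    (a₂ * Q * Δ₀ + a₂ * Q * Qᵀ * (a₀ * Q) + (2 : ℝ) • (a₁ * Q * Δ₁ + a₁ * Q * Qᵀ * (a₁ * Q)) + (a₀ * Q * Δ₂ + a₀ * Q * Qᵀ * (a₂ * Q)))
    (Δ₀ * Qᵀ * a₀) (Δ₁ * Qᵀ * a₀ + Δ₀ * Qᵀ * a₁) (Δ₂ * Qᵀ * a₀ + (2 : ℝ) • (Δ₁ * Qᵀ * a₁) + Δ₀ * Qᵀ * a₂) ?_ ?_ ?_ hd
  · rw [hX₀', hX₀, hM₀]
    simp only [Matrix.add_mul, Matrix.mul_add, Matrix.mul_assoc]; abel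
  · rw [hX₁', hX₁, hM₀, hM₁]
    simp only [Matrix.add_mul, Matrix.mul_add, Matrix.transpose_zero, Matrix.zero_mul, Matrix.mul_zero, add_zero, Matrix.mul_assoc]
    abel
  · rw [hX₂', hX₂, hM₀, hM₁, hM₂]
    simp only [Matrix.add_mul, Matrix.mul_add, smul_add, Matrix.transpose_zero, Matrix.zero_mul, Matrix.mul_zero, smul_zero, add_zero,
      Matrix.mul_assoc, two_smul]
    abel

/-- [folklore] **THE SHIFT CONGRUENCE, MIXED JET FORM** (constant `Q`; first jets `Δₛ Δₜ`, mixed second jet `Δₛₜ`; `Mᵢ = Δᵢ + Qᵀ(aᵢQ)`; the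
derived square jets `Xₛ = ΔₛΔ₀ + Δ₀Δₛ`, `Xₛₜ = ΔₛₜΔ₀ + ΔₛΔₜ + ΔₜΔₛ + Δ₀Δₛₜ`, likewise primed):
`mixedVar (kkt X₀ Q) (kkt Xₛ 0) (kkt Xₜ 0) (kkt Xₛₜ 0) = mixedVar (kkt X₀′ Q) (kkt Xₛ′ 0) (kkt Xₜ′ 0) (kkt Xₛₜ′ 0)`. -/
theorem mixedVar_kkt_shift_sq_jets (Δ₀ Δₛ Δₜ Δₛₜ M₀ Mₛ Mₜ Mₛₜ X₀ Xₛ Xₜ Xₛₜ X₀' Xₛ' Xₜ' Xₛₜ' : Matrix ν ν ℝ) (Q : Matrix μ ν ℝ)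
    (a₀ aₛ aₜ aₛₜ : Matrix μ μ ℝ)
    (hM₀ : M₀ = Δ₀ + Qᵀ * (a₀ * Q)) (hMₛ : Mₛ = Δₛ + Qᵀ * (aₛ * Q)) (hMₜ : Mₜ = Δₜ + Qᵀ * (aₜ * Q)) (hMₛₜ : Mₛₜ = Δₛₜ + Qᵀ * (aₛₜ * Q))
    (hX₀ : X₀ = Δ₀ * Δ₀) (hXₛ : Xₛ = Δₛ * Δ₀ + Δ₀ * Δₛ) (hXₜ : Xₜ = Δₜ * Δ₀ + Δ₀ * Δₜ)
    (hXₛₜ : Xₛₜ = Δₛₜ * Δ₀ + Δₛ * Δₜ + Δₜ * Δₛ + Δ₀ * Δₛₜ)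
    (hX₀' : X₀' = M₀ * M₀) (hXₛ' : Xₛ' = Mₛ * M₀ + M₀ * Mₛ) (hXₜ' : Xₜ' = Mₜ * M₀ + M₀ * Mₜ)
    (hXₛₜ' : Xₛₜ' = Mₛₜ * M₀ + Mₛ * Mₜ + Mₜ * Mₛ + M₀ * Mₛₜ)
    (hd : (kkt X₀ Q).det ≠ 0) :
    mixedVar (kkt X₀ Q) (kkt Xₛ (0 : Matrix μ ν ℝ)) (kkt Xₜ (0 : Matrix μ ν ℝ)) (kkt Xₛₜ (0 : Matrix μ ν ℝ))
      = mixedVar (kkt X₀' Q) (kkt Xₛ' (0 : Matrix μ ν ℝ)) (kkt Xₜ' (0 : Matrix μ ν ℝ)) (kkt Xₛₜ' (0 : Matrix μ ν ℝ)) := by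
  -- part `s`, part `t` (zero pure second jets of `Δ`, `a`; the squares then have pure second jets `2·ΔₛΔₛ`, `2·MₛMₛ`)
  have hs := secondVar_kkt_shift_sq_jets Δ₀ Δₛ 0 M₀ Mₛ 0 X₀ Xₛ ((2 : ℝ) • (Δₛ * Δₛ)) X₀' Xₛ' ((2 : ℝ) • (Mₛ * Mₛ)) Q a₀ aₛ 0
    hM₀ hMₛ (by simp) hX₀ hXₛ (by simp) hX₀' hXₛ' (by simp) hd
  have ht := secondVar_kkt_shift_sq_jets Δ₀ Δₜ 0 M₀ Mₜ 0 X₀ Xₜ ((2 : ℝ) • (Δₜ * Δₜ)) X₀' Xₜ' ((2 : ℝ) • (Mₜ * Mₜ)) Q a₀ aₜ 0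
    hM₀ hMₜ (by simp) hX₀ hXₜ (by simp) hX₀' hXₜ' (by simp) hd
  -- the diagonal `s + t` (pure second jets `0 + 2·Δₛₜ + 0`, `0 + 2·aₛₜ + 0`)
  have hdg := secondVar_kkt_shift_sq_jets Δ₀ (Δₛ + Δₜ) (0 + (2 : ℝ) • Δₛₜ + 0) M₀ (Mₛ + Mₜ) (0 + (2 : ℝ) • Mₛₜ + 0) X₀ (Xₛ + Xₜ)
    ((2 : ℝ) • (Δₛ * Δₛ) + (2 : ℝ) • Xₛₜ + (2 : ℝ) • (Δₜ * Δₜ)) X₀' (Xₛ' + Xₜ')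
    ((2 : ℝ) • (Mₛ * Mₛ) + (2 : ℝ) • Xₛₜ' + (2 : ℝ) • (Mₜ * Mₜ)) Q a₀ (aₛ + aₜ) (0 + (2 : ℝ) • aₛₜ + 0) hM₀
    (by rw [hMₛ, hMₜ, Matrix.add_mul, Matrix.mul_add]; abel)
    (by rw [hMₛₜ]; simp only [zero_add, add_zero, Matrix.smul_mul, Matrix.mul_smul, smul_add])
    hX₀ (by rw [hXₛ, hXₜ, Matrix.add_mul, Matrix.mul_add]; abel)
    (by rw [hXₛₜ]; simp only [zero_add, add_zero, Matrix.add_mul, Matrix.mul_add, smul_add, two_smul]; abel)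
    hX₀' (by rw [hXₛ', hXₜ', Matrix.add_mul, Matrix.mul_add]; abel)
    (by rw [hXₛₜ']; simp only [zero_add, add_zero, Matrix.add_mul, Matrix.mul_add, smul_add, two_smul]; abel)
    hd
  rw [kkt_zero_polar, kkt_zero_polar, kkt_add_zero, kkt_add_zero] at hdg
  have p := two_mul_mixedVar_eq_polar (kkt X₀ Q) (kkt Xₛ (0 : Matrix μ ν ℝ)) (kkt Xₜ 0) (kkt ((2 : ℝ) • (Δₛ * Δₛ)) 0)
    (kkt ((2 : ℝ) • (Δₜ * Δₜ)) 0) (kkt Xₛₜ 0)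
  have p' := two_mul_mixedVar_eq_polar (kkt X₀' Q) (kkt Xₛ' (0 : Matrix μ ν ℝ)) (kkt Xₜ' 0) (kkt ((2 : ℝ) • (Mₛ * Mₛ)) 0)
    (kkt ((2 : ℝ) • (Mₜ * Mₜ)) 0) (kkt Xₛₜ' 0)
  linarith

/-- [folklore] **THE SHIFT CONGRUENCE IN THE `hessT` CURRENCY**: under the letters of `mixedVar_kkt_shift_sq_jets`,
`hessT (kkt X₀ Q)⁻¹ (kkt Xₛ 0) (kkt Xₜ 0) (kkt Xₛₜ 0) = hessT (kkt X₀′ Q)⁻¹ (kkt Xₛ′ 0) (kkt Xₜ′ 0) (kkt Xₛₜ′ 0)`. -/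
theorem hessT_kkt_shift_sq_jets (Δ₀ Δₛ Δₜ Δₛₜ M₀ Mₛ Mₜ Mₛₜ X₀ Xₛ Xₜ Xₛₜ X₀' Xₛ' Xₜ' Xₛₜ' : Matrix ν ν ℝ) (Q : Matrix μ ν ℝ)
    (a₀ aₛ aₜ aₛₜ : Matrix μ μ ℝ)
    (hM₀ : M₀ = Δ₀ + Qᵀ * (a₀ * Q)) (hMₛ : Mₛ = Δₛ + Qᵀ * (aₛ * Q)) (hMₜ : Mₜ = Δₜ + Qᵀ * (aₜ * Q)) (hMₛₜ : Mₛₜ = Δₛₜ + Qᵀ * (aₛₜ * Q))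
    (hX₀ : X₀ = Δ₀ * Δ₀) (hXₛ : Xₛ = Δₛ * Δ₀ + Δ₀ * Δₛ) (hXₜ : Xₜ = Δₜ * Δ₀ + Δ₀ * Δₜ)
    (hXₛₜ : Xₛₜ = Δₛₜ * Δ₀ + Δₛ * Δₜ + Δₜ * Δₛ + Δ₀ * Δₛₜ)
    (hX₀' : X₀' = M₀ * M₀) (hXₛ' : Xₛ' = Mₛ * M₀ + M₀ * Mₛ) (hXₜ' : Xₜ' = Mₜ * M₀ + M₀ * Mₜ)
    (hXₛₜ' : Xₛₜ' = Mₛₜ * M₀ + Mₛ * Mₜ + Mₜ * Mₛ + M₀ * Mₛₜ)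
    (hd : (kkt X₀ Q).det ≠ 0) :
    hessT (kkt X₀ Q)⁻¹ (kkt Xₛ (0 : Matrix μ ν ℝ)) (kkt Xₜ (0 : Matrix μ ν ℝ)) (kkt Xₛₜ (0 : Matrix μ ν ℝ))
      = hessT (kkt X₀' Q)⁻¹ (kkt Xₛ' (0 : Matrix μ ν ℝ)) (kkt Xₜ' (0 : Matrix μ ν ℝ)) (kkt Xₛₜ' (0 : Matrix μ ν ℝ)) := by
  have h := mixedVar_kkt_shift_sq_jets Δ₀ Δₛ Δₜ Δₛₜ M₀ Mₛ Mₜ Mₛₜ X₀ Xₛ Xₜ Xₛₜ X₀' Xₛ' Xₜ' Xₛₜ' Q a₀ aₛ aₜ aₛₜ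
    hM₀ hMₛ hMₜ hMₛₜ hX₀ hXₛ hXₜ hXₛₜ hX₀' hXₛ' hXₜ' hXₛₜ' hd
  rw [mixedVar_eq_two_mul_hessT, mixedVar_eq_two_mul_hessT] at h
  linarith

end Shift

end Summit.QuantumFields.BalabanUV.Beta.D1BFx.GhostCompressionJets

end
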